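import Mathlib

/-!
# Route `SmallBetaInfraredSplit` (sub QCD), support item `WickSecondVariation` (stmt-QuantumFields-23766) —
# part 1: the linear algebra of the second coefficient of `s ↦ det(sA + B)`

Generic, model-free lemmas (any commutative ring / field):
* `det_X_smul_add_eq_C_det_mul` — Jacobi's factorisation `det(X•A + B) = det B · det(1 + X•B⁻¹A)` for `det B` a unit;
* `coeff_two_det_X_smul_add` — hence the `X²`-coefficient is `det B · Σ_{|s|=2} det((B⁻¹A)_{s,s})`
  (Mathlib's `Matrix.coeff_det_one_add_X_smul_eq_sum_minors`);
* `det_submatrix_pair`, `two_mul_sum_powersetCard_two_det` — the sum of the `2 × 2` principal minors as a double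
  sum `½ Σ_i Σ_j (M_ii M_jj − M_ij M_ji)`;
* `sum_sum_mul_diagonal_eq` — for `M = G · diag(c ∘ fst)` on colour–site indices this double sum is
  `Σ_x Σ_y c_x c_y W_xy(G)` with the Wick form `W_xy(G) = tr G_xx tr G_yy − tr(G_xy G_yx)`;
* `eval_det_X_smul_add`, `coeff_det_X_smul_add_eq_sum_lagrange` — evaluation and the Lagrange formula for
  the coefficients (used for continuity in the gauge field);
* `inv_neg_eq`, `conj_wick_of_conjTranspose_eq_neg` — the Wick form of an anti-Hermitian propagator is real.

HONEST FRAMING: helper algebra for a support item of a DRAFT-by-design QCD-side line (LADDER-YM rung Q1,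
RECORD label); nothing about `QCD`, `YangMills`, a mass gap or a continuum limit is proved here. [folklore]
-/

set_option autoImplicit false

namespace Summit.QuantumFields.QCD.Theorems.SmallBetaInfraredSplit.WickAlgebra

open Matrix Polynomial Finset

section CommRing

variable {R : Type*} [CommRing R] {n : Type*} [DecidableEq n] [Fintype n]

/-- **Jacobi's factorisation**: for `det B` a unit, `det(X•A + B) = det B · det(1 + X•(B⁻¹A))` as polynomials.
[folklore] -/
theorem det_X_smul_add_eq_C_det_mul (A B : Matrix n n R) (hB : IsUnit B.det) :
    det ((X : R[X]) • A.map C + B.map C) = C B.det * det (1 + (X : R[X]) • (B⁻¹ * A).map C) := by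
  have h : (X : R[X]) • A.map C + B.map C =
      B.map C * (1 + (X : R[X]) • (B⁻¹ * A).map (C : R →+* R[X])) := by
    rw [Matrix.mul_add, Matrix.mul_one, Matrix.mul_smul, ← Matrix.map_mul,
      Matrix.mul_nonsing_inv_cancel_left B A hB, add_comm]
  rw [h, det_mul]
  congr 1
  have := (RingHom.map_det (C : R →+* R[X]) B).symm
  rw [RingHom.mapMatrix_apply] at this
  exact this.symm ▸ rfl

/-- The `X²`-coefficient of `det(X•A + B)` for `det B` a unit: `det B · Σ_{|s| = 2} det((B⁻¹A)_{s,s})`.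
[folklore] -/
theorem coeff_two_det_X_smul_add (A B : Matrix n n R) (hB : IsUnit B.det) :
    (det ((X : R[X]) • A.map C + B.map C)).coeff 2 =
      B.det * ∑ s ∈ (univ : Finset n).powersetCard 2,
        ((B⁻¹ * A).submatrix (Subtype.val : s → n) (Subtype.val : s → n)).det := by
  rw [det_X_smul_add_eq_C_det_mul A B hB, coeff_C_mul, Matrix.coeff_det_one_add_X_smul_eq_sum_minors]

omit [Fintype n] in
/-- A `2 × 2` principal minor written out: `det M_{{x,y},{x,y}} = M_xx M_yy − M_xy M_yx` (`x ≠ y`). [folklore] -/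
theorem det_submatrix_pair (M : Matrix n n R) {x y : n} (hxy : x ≠ y) :
    (M.submatrix (Subtype.val : (({x, y} : Finset n)) → n) (Subtype.val : (({x, y} : Finset n)) → n)).det =
      M x x * M y y - M x y * M y x := by
  have hx : x ∈ ({x, y} : Finset n) := by simp
  have hy : y ∈ ({x, y} : Finset n) := by simp
  let e : Fin 2 → (({x, y} : Finset n)) := ![⟨x, hx⟩, ⟨y, hy⟩]
  have he : Function.Bijective e := by
    refine ⟨?_, ?_⟩
    · intro a b hab
      fin_cases a <;> fin_cases b
      · rfl
      · exact absurd (congrArg Subtype.val hab) (by simpa [e] using hxy)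
      · exact absurd (congrArg Subtype.val hab) (by simpa [e] using hxy.symm)
      · rfl
    · rintro ⟨z, hz⟩
      rw [Finset.mem_insert, Finset.mem_singleton] at hz
      rcases hz with rfl | rfl
      · exact ⟨0, rfl⟩
      · exact ⟨1, rfl⟩
  rw [← Matrix.det_submatrix_equiv_self (Equiv.ofBijective e he), Matrix.det_fin_two]
  simp [e]

/-- **The sum of the `2 × 2` principal minors as a double sum**:
`2 Σ_{|s|=2} det M_{s,s} = Σ_i Σ_j (M_ii M_jj − M_ij M_ji)` (the diagonal terms vanish; each unordered pair is
counted twice). [folklore] -/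
theorem two_mul_sum_powersetCard_two_det (M : Matrix n n R) :
    2 * ∑ s ∈ (univ : Finset n).powersetCard 2,
        (M.submatrix (Subtype.val : s → n) (Subtype.val : s → n)).det =
      ∑ i, ∑ j, (M i i * M j j - M i j * M j i) := by
  classical
  set g : Finset n → R := fun t => (M.submatrix (Subtype.val : t → n) (Subtype.val : t → n)).det with hg
  -- the double sum as a sum over ordered off-diagonal pairs
  have h1 : ∑ i, ∑ j, (M i i * M j j - M i j * M j i) =
      ∑ p ∈ (univ : Finset n).offDiag, g {p.1, p.2} := by
    have e1 : ∑ i, ∑ j, (M i i * M j j - M i j * M j i) =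
        ∑ p ∈ (univ : Finset n) ×ˢ (univ : Finset n), (M p.1 p.1 * M p.2 p.2 - M p.1 p.2 * M p.2 p.1) := by
      rw [Finset.sum_product]
    rw [e1, ← Finset.diag_union_offDiag, Finset.sum_union (Finset.disjoint_diag_offDiag _)]
    have hdiag : ∑ p ∈ (univ : Finset n).diag, (M p.1 p.1 * M p.2 p.2 - M p.1 p.2 * M p.2 p.1) = 0 :=
      Finset.sum_eq_zero fun p hp => by
        rw [Finset.mem_diag] at hp
        rw [hp.2]; ring
    rw [hdiag, zero_add]
    refine Finset.sum_congr rfl fun p hp => ?_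
    rw [Finset.mem_offDiag] at hp
    simp only [hg, det_submatrix_pair M hp.2.2]
  -- each unordered pair has exactly two ordered representatives
  have himg : (univ : Finset n).offDiag.image (fun p : n × n => ({p.1, p.2} : Finset n)) =
      (univ : Finset n).powersetCard 2 := by
    ext t
    simp only [Finset.mem_image, Finset.mem_offDiag, Finset.mem_univ, true_and,
      Finset.mem_powersetCard, Finset.subset_univ, Finset.card_eq_two]
    constructor
    · rintro ⟨p, hp, rfl⟩
      exact ⟨p.1, p.2, hp, rfl⟩
    · rintro ⟨a, b, hab, rfl⟩
      exact ⟨(a, b), hab, rfl⟩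
  have h2 : ∑ p ∈ (univ : Finset n).offDiag, g {p.1, p.2} =
      ∑ t ∈ (univ : Finset n).powersetCard 2, 2 • g t := by
    rw [Finset.sum_comp, himg]
    refine Finset.sum_congr rfl fun t ht => ?_
    obtain ⟨a, b, hab, rfl⟩ := Finset.card_eq_two.1 (Finset.mem_powersetCard.1 ht).2
    congr 1
    have hfib : ((univ : Finset n).offDiag.filter
        (fun p : n × n => ({p.1, p.2} : Finset n) = {a, b})) = {(a, b), (b, a)} := by
      ext ⟨u, v⟩
      simp only [Finset.mem_filter, Finset.mem_offDiag, Finset.mem_univ, true_and, Finset.mem_insert,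
        Finset.mem_singleton, Prod.mk.injEq]
      constructor
      · rintro ⟨-, h⟩
        have h' : ({u, v} : Set n) = {a, b} := by
          rw [← Finset.coe_pair, ← Finset.coe_pair, h]
        exact Set.pair_eq_pair_iff.1 h'
      · rintro (⟨rfl, rfl⟩ | ⟨rfl, rfl⟩)
        · exact ⟨hab, rfl⟩
        · exact ⟨hab.symm, Finset.pair_comm _ _⟩
    rw [hfib, Finset.card_pair]
    intro h
    exact hab (Prod.mk.inj h).1
  rw [h1, h2, Finset.mul_sum]
  refine Finset.sum_congr rfl fun t _ => ?_
  simp only [hg, two_mul, two_nsmul]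

/-- **Regrouping by sites**: for `M = G · diag(c ∘ fst)` on colour–site indices `(x, a)`,
`Σ_i Σ_j (M_ii M_jj − M_ij M_ji) = Σ_x Σ_y c_x c_y W_xy(G)` with
`W_xy(G) = (Σ_a G_{(x,a)(x,a)})(Σ_b G_{(y,b)(y,b)}) − Σ_{a,b} G_{(x,a)(y,b)} G_{(y,b)(x,a)}`. [folklore] -/
theorem sum_sum_mul_diagonal_eq {X : Type*} [Fintype X] [DecidableEq X] {N : ℕ}
    (G : Matrix (X × Fin N) (X × Fin N) R) (c : X → R) :
    let M := G * diagonal (fun i : X × Fin N => c i.1)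
    ∑ i, ∑ j, (M i i * M j j - M i j * M j i) =
      ∑ x, ∑ y, c x * c y *
        ((∑ a : Fin N, G (x, a) (x, a)) * (∑ b : Fin N, G (y, b) (y, b)) -
          ∑ a : Fin N, ∑ b : Fin N, G (x, a) (y, b) * G (y, b) (x, a)) := by
  intro M
  simp only [M, Matrix.mul_diagonal]
  rw [Fintype.sum_prod_type]
  refine Finset.sum_congr rfl fun x _ => ?_
  -- swap the colour sum at `x` with the site sum over `y`
  have hswap : ∑ a : Fin N, ∑ j : X × Fin N,
      (G (x, a) (x, a) * c x * (G j j * c j.1) - G (x, a) j * c j.1 * (G j (x, a) * c x)) =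
      ∑ y : X, ∑ a : Fin N, ∑ b : Fin N,
        (G (x, a) (x, a) * c x * (G (y, b) (y, b) * c y) - G (x, a) (y, b) * c y * (G (y, b) (x, a) * c x)) := by
    calc ∑ a : Fin N, ∑ j : X × Fin N,
          (G (x, a) (x, a) * c x * (G j j * c j.1) - G (x, a) j * c j.1 * (G j (x, a) * c x))
        = ∑ a : Fin N, ∑ y : X, ∑ b : Fin N,
          (G (x, a) (x, a) * c x * (G (y, b) (y, b) * c y) - G (x, a) (y, b) * c y * (G (y, b) (x, a) * c x)) := by
          simp_rw [Fintype.sum_prod_type]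
      _ = _ := Finset.sum_comm
  rw [hswap]
  refine Finset.sum_congr rfl fun y _ => ?_
  rw [mul_sub, Finset.sum_mul_sum, Finset.mul_sum, Finset.mul_sum]
  simp_rw [Finset.mul_sum, ← Finset.sum_sub_distrib]
  exact Finset.sum_congr rfl fun a _ => Finset.sum_congr rfl fun b _ => by ring

/-- Evaluation: `det(X•A + B)(s) = det(s•A + B)`. [folklore] -/
theorem eval_det_X_smul_add (A B : Matrix n n R) (s : R) :
    (det ((X : R[X]) • A.map C + B.map C)).eval s = det (s • A + B) := by
  have h := RingHom.map_det (Polynomial.evalRingHom s) ((X : R[X]) • A.map C + B.map C)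
  rw [RingHom.mapMatrix_apply] at h
  rw [Polynomial.coe_evalRingHom] at h
  rw [h]
  congr 1
  ext i j
  simp only [Matrix.map_apply, Matrix.add_apply, Matrix.smul_apply, smul_eq_mul, eval_add, eval_mul, eval_X,
    eval_C]

end CommRing

section Field

variable {F : Type*} [Field F] {n : Type*} [DecidableEq n] [Fintype n]

/-- `(−B)⁻¹ = −B⁻¹` for the matrix inverse (both junk `0` when `det B` is not a unit). [folklore] -/
theorem inv_neg_eq (B : Matrix n n F) : (-B)⁻¹ = -B⁻¹ := by
  by_cases h : IsUnit B.det
  · exact Matrix.inv_eq_left_inv (by rw [neg_mul_neg, Matrix.nonsing_inv_mul _ h])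
  · have h' : ¬IsUnit (-B).det := by
      rw [Matrix.det_neg]
      exact fun hu => h (IsUnit.mul_iff.1 hu).2
    rw [Matrix.nonsing_inv_apply_not_isUnit _ h, Matrix.nonsing_inv_apply_not_isUnit _ h', neg_zero]

/-- **Lagrange formula for the coefficients** (characteristic zero): with the nodes `0, 1, …, |n|`,
`coeff_k det(X•A + B) = Σ_j ℓ_j,k · det(j•A + B)`, `ℓ_j` the Lagrange basis polynomials — the coefficients
are fixed linear combinations of finitely many evaluations. [folklore] -/
theorem coeff_det_X_smul_add_eq_sum_lagrange [CharZero F] (A B : Matrix n n F) (k : ℕ) :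
    (det ((X : F[X]) • A.map C + B.map C)).coeff k =
      ∑ j : Fin (Fintype.card n + 1),
        (Lagrange.basis (univ : Finset (Fin (Fintype.card n + 1))) (fun j => ((j : ℕ) : F)) j).coeff k *
          det (((j : ℕ) : F) • A + B) := by
  set v : Fin (Fintype.card n + 1) → F := fun j => ((j : ℕ) : F) with hv
  have hvs : Set.InjOn v (univ : Finset (Fin (Fintype.card n + 1))) := by
    intro i _ j _ hij
    exact Fin.ext (Nat.cast_injective (R := F) hij)
  have hdeg : (det ((X : F[X]) • A.map C + B.map C)).degree <
      (univ : Finset (Fin (Fintype.card n + 1))).card := by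
    rw [Finset.card_univ, Fintype.card_fin]
    refine lt_of_le_of_lt (Polynomial.degree_le_of_natDegree_le (Polynomial.natDegree_det_X_add_C_le A B)) ?_
    exact_mod_cast Nat.lt_succ_self _
  have h := Lagrange.eq_interpolate hvs hdeg
  conv_lhs => rw [h]
  rw [Lagrange.interpolate_apply, Polynomial.finsetSum_coeff]
  refine Finset.sum_congr rfl fun j _ => ?_
  rw [Polynomial.coeff_C_mul, eval_det_X_smul_add, mul_comm]

end Field

section Wick

variable {X : Type*} {N : ℕ}

/-- The Wick form of an ANTI-HERMITIAN propagator is real: if `Gᴴ = −G` then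
`conj W_xy(G) = W_xy(G)` (`tr G_xx ∈ iℝ`, `G_{yb,xa} = −conj G_{xa,yb}`). [folklore] -/
theorem conj_wick_of_conjTranspose_eq_neg (G : Matrix (X × Fin N) (X × Fin N) ℂ) (hG : Gᴴ = -G) (x y : X) :
    starRingEnd ℂ ((∑ a : Fin N, G (x, a) (x, a)) * (∑ b : Fin N, G (y, b) (y, b)) -
        ∑ a : Fin N, ∑ b : Fin N, G (x, a) (y, b) * G (y, b) (x, a)) =
      (∑ a : Fin N, G (x, a) (x, a)) * (∑ b : Fin N, G (y, b) (y, b)) -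
        ∑ a : Fin N, ∑ b : Fin N, G (x, a) (y, b) * G (y, b) (x, a) := by
  have h : ∀ i j, starRingEnd ℂ (G i j) = -G j i := fun i j => by
    have := congrFun (congrFun hG j) i
    rw [Matrix.conjTranspose_apply, Matrix.neg_apply] at this
    exact this
  simp only [map_sub, map_mul, map_sum, h]
  rw [Finset.sum_neg_distrib, Finset.sum_neg_distrib, neg_mul_neg]
  congr 1
  exact Finset.sum_congr rfl fun a _ => Finset.sum_congr rfl fun b _ => by ring

/-- Hence its imaginary part vanishes. [folklore] -/
theorem wick_im_eq_zero_of_conjTranspose_eq_neg (G : Matrix (X × Fin N) (X × Fin N) ℂ) (hG : Gᴴ = -G)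
    (x y : X) :
    ((∑ a : Fin N, G (x, a) (x, a)) * (∑ b : Fin N, G (y, b) (y, b)) -
        ∑ a : Fin N, ∑ b : Fin N, G (x, a) (y, b) * G (y, b) (x, a)).im = 0 :=
  Complex.conj_eq_iff_im.1 (conj_wick_of_conjTranspose_eq_neg G hG x y)

end Wick

end Summit.QuantumFields.QCD.Theorems.SmallBetaInfraredSplit.WickAlgebra
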